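import Mathlib
import HarnessLib
import Summits.HubbardSuperconductivity.HubbardSuperconductivity.Theorems.KLProgrammeC4aLatticeMomentumSum
import Summits.HubbardSuperconductivity.HubbardSuperconductivity.Theorems.KLProgrammeKLRegimeSliceSymbolTorus

/-!
# Route `KLProgramme` — crux C4a, LAYER 2 of the tadpole representation, second brick: the lattice TUBE sum
# `L⁻²·Σ_{k⃗ ∈ ℤ_L²} f(e_K(p_k⃗))·V(p_k⃗)` is `(2π)⁻²·∫_{tube} f(e_K q)·V(q) dq` up to aliased Fourier coefficients

Cell `gate-hubbard-kl`, lane hubbard-kl-c4a-1 (g3); helper for stub (C) `stub_twoLeg_curvature` of the engine-flow child `KLRegimeEngineV17F2`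
(stmt-HubbardSuperconductivity-20437); memo HOME/hubbard-kl-c4a-1/C4A-PLAN.md §15.5 (finding F3) / §16.  Chains the grid bridge of
`…C4aLatticeMomentumSum` (`norm_latticeMomentumAvg_sub_zoneIntegral_le`: grid average = zone average `(2π)⁻²∫_{[−π,π)²}` + aliased tail) with the
SUPPORT GEOMETRY of the tube tadpole-jet theorem (…C4aTubeTadpole): for a slice profile `f` of the level with `tsupport f ⊆ (−r, r)` the integrand
`Φ(q) = f(e_K(q))·V(q)` vanishes on the square off the tube `{|q₁|, |q₂| < π, |e_K(q)| < r}`, so the zone integral IS the tube integral of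
`norm_iteratedDeriv_tubeTadpole_le`'s left-hand side (before the `θ`-jets):

* §1 `frameLevel_periodic_single` (the frame band `e_K` in the coordinate-periodicity form), `contDiff_levelVertex`, `levelVertex_periodic_single`
  (`Φ = (f ∘ e_K)·V` is smooth and `2π`-periodic);
* §2 `setIntegral_zoneBox_eq_tube` — `∫_{[−π,π)²} Φ = ∫_{tube} Φ` (the edges are null; off the tube `f(e_K q) = 0`);
* §3 **`norm_latticeTubeAvg_sub_tubeIntegral_le`** — `‖L⁻²·Σ_{k⃗} f(e_K(p_k⃗))·V(p_k⃗) − (2π)⁻²·∫_{tube} f(e_K q)·V(q) dq‖ ≤ Σ_{m ≠ 0, L ∣ m} ‖𝓕(Φ♭)(m)‖`,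
  `Φ♭` the descent of `y ↦ Φ(2πy)`; the right-hand side is estimated by Literature `…Fourier.TorusFourierTailSmooth` /
  `…Fourier.TorusGridAliasingTail` in LAYER 2 proper (the slice profile lives at scale `Λ_{n+1}`, `V` is a trigonometric polynomial of the frame's
  four-leg kernel; the engine's volume threshold `le_L_mul_klScale_of_klEngL₃_le` (k3c3-p3, (R56)) makes the tail negligible).

Pure bookkeeping; nothing is asserted about the Hubbard model.  References: BGM 2006 §2.1 (2.3), §2.3 (2.17)–(2.23) [cite: BenfattoGiulianiMastropietro2006].
-/

noncomputable section

namespace Summit.HubbardSuperconductivity.HubbardSuperconductivity.Theorems.C4a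

set_option linter.dupNamespace false -- summit = problem name (single-conjunct summit), D-0017

open Real Set MeasureTheory UnitAddTorus
open Literature.Probability.LatticeModels Literature.MathematicalPhysics.QuantumLattice
open Literature.Analysis.Fourier Literature.Analysis.FunctionSpaces
open Summit.HubbardSuperconductivity.HubbardSuperconductivity.Theorems.DispersionFlow
open Summit.HubbardSuperconductivity.HubbardSuperconductivity.Theorems.TorusFourierL2

/-! ## §1 The integrand `Φ = (f ∘ e_K)·V` is smooth and `2π`-periodic -/

/-- **The frame band is `2π`-periodic in each momentum coordinate** (coordinate form of `frameLevel_toLp_periodic`). -/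
theorem frameLevel_periodic_single (μ : ℝ) (K : TrigPolyC4v) (j : Fin 2) (q : Momentum) :
    frameLevel μ K (q + EuclideanSpace.single j (2 * π)) = frameLevel μ K q :=
  periodic_single_of_planePeriodic (Φ := frameLevel μ K) (fun p m => by
    have h := frameLevel_toLp_periodic μ K p m
    have e : (fun i => p i + 2 * π * (m i : ℝ)) = fun i => p i + (m i : ℝ) * (2 * π) := by funext i; ring
    rw [e] at h
    exact h) j q

/-- `Φ = (f ∘ e_K)·V` is smooth for smooth `f`, `V`. -/
theorem contDiff_levelVertex (μ : ℝ) (K : TrigPolyC4v) {f : ℝ → ℂ} (hf : ContDiff ℝ (⊤ : ℕ∞) f) {V : Momentum → ℂ}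
    (hV : ContDiff ℝ (⊤ : ℕ∞) V) : ContDiff ℝ (⊤ : ℕ∞) fun q : Momentum => f (frameLevel μ K q) * V q :=
  (hf.comp (EngineV8.contDiff_frameLevel μ K)).mul hV

/-- `Φ = (f ∘ e_K)·V` is `2π`-periodic in each coordinate when `V` is. -/
theorem levelVertex_periodic_single (μ : ℝ) (K : TrigPolyC4v) (f : ℝ → ℂ) {V : Momentum → ℂ}
    (hVper : ∀ (j : Fin 2) (q : Momentum), V (q + EuclideanSpace.single j (2 * π)) = V q) (j : Fin 2) (q : Momentum) :
    (fun q : Momentum => f (frameLevel μ K q) * V q) (q + EuclideanSpace.single j (2 * π)) = (fun q : Momentum => f (frameLevel μ K q) * V q) q := by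
  simp only [frameLevel_periodic_single, hVper]

/-! ## §2 The zone integral is the tube integral -/

/-- **`∫_{[−π,π)²} f(e_K q)·V(q) dq = ∫_{tube} f(e_K q)·V(q) dq`** for `tsupport f ⊆ (−r, r)`: the two edges `q_i = −π` are null and off the tube
`f(e_K q) = 0`. -/
theorem setIntegral_zoneBox_eq_tube (μ : ℝ) (K : TrigPolyC4v) {r : ℝ} {f : ℝ → ℂ} (hfsupp : tsupport f ⊆ Ioo (-r) r) (V : Momentum → ℂ) :
    ∫ p in Ico (-π) π ×ˢ Ico (-π) π, f (frameLevel μ K (WithLp.toLp 2 ![p.1, p.2])) * V (WithLp.toLp 2 ![p.1, p.2]) =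
      ∫ p in {q : ℝ × ℝ | |q.1| < π ∧ |q.2| < π ∧ |frameLevel μ K (WithLp.toLp 2 ![q.1, q.2])| < r},
        f (frameLevel μ K (WithLp.toLp 2 ![p.1, p.2])) * V (WithLp.toLp 2 ![p.1, p.2]) := by
  -- the edges are null
  have hae : (Ico (-π) π ×ˢ Ico (-π) π : Set (ℝ × ℝ)) =ᵐ[volume] (Ioo (-π) π ×ˢ Ioo (-π) π : Set (ℝ × ℝ)) :=
    Measure.set_prod_ae_eq (Ioo_ae_eq_Ico (μ := volume) (a := -π) (b := π)).symm (Ioo_ae_eq_Ico (μ := volume) (a := -π) (b := π)).symm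
  rw [setIntegral_congr_set hae]
  -- off the tube the slice profile vanishes
  refine setIntegral_eq_of_subset_of_forall_sdiff_eq_zero (measurableSet_Ioo.prod measurableSet_Ioo) ?_ ?_
  · rintro q ⟨h1, h2, -⟩
    exact ⟨abs_lt.1 h1, abs_lt.1 h2⟩
  · rintro q ⟨⟨h1, h2⟩, hq⟩
    have hq' : ¬ |frameLevel μ K (WithLp.toLp 2 ![q.1, q.2])| < r := fun h => hq ⟨abs_lt.2 h1, abs_lt.2 h2, h⟩
    have h0 : f (frameLevel μ K (WithLp.toLp 2 ![q.1, q.2])) = 0 := by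
      refine image_eq_zero_of_notMem_tsupport fun hmem => hq' ?_
      exact abs_lt.2 (hfsupp hmem)
    rw [h0, zero_mul]

/-! ## §3 The lattice tube sum against the tube integral -/

/-- **THE LATTICE TUBE SUM** (finding F3, second brick): for a smooth slice profile `f` with `tsupport f ⊆ (−r, r)` and a smooth `2π`-periodic vertex
factor `V` on the momentum plane,
`‖L⁻²·Σ_{k⃗ ∈ ℤ_L²} f(e_K(p_k⃗))·V(p_k⃗) − (2π)⁻²·∫_{tube} f(e_K q)·V(q) dq‖ ≤ Σ_{m ≠ 0, L ∣ m} ‖𝓕(Φ♭)(m)‖`, `Φ = (f ∘ e_K)·V`.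
[cite: BenfattoGiulianiMastropietro2006, §2.1 (2.3)] -/
theorem norm_latticeTubeAvg_sub_tubeIntegral_le {L : ℕ} [NeZero L] (μ : ℝ) (K : TrigPolyC4v) {r : ℝ} {f : ℝ → ℂ}
    (hf : ContDiff ℝ (⊤ : ℕ∞) f) (hfsupp : tsupport f ⊆ Ioo (-r) r) {V : Momentum → ℂ} (hV : ContDiff ℝ (⊤ : ℕ∞) V)
    (hVper : ∀ (j : Fin 2) (q : Momentum), V (q + EuclideanSpace.single j (2 * π)) = V q) :
    ‖((L : ℂ) ^ 2)⁻¹ * ∑ k : TorusSite 2 L, f (frameLevel μ K (WithLp.toLp 2 (latticeMomentum L k))) * V (WithLp.toLp 2 (latticeMomentum L k)) -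
        ((2 * π) ^ 2)⁻¹ • ∫ p in {q : ℝ × ℝ | |q.1| < π ∧ |q.2| < π ∧ |frameLevel μ K (WithLp.toLp 2 ![q.1, q.2])| < r},
          f (frameLevel μ K (WithLp.toLp 2 ![p.1, p.2])) * V (WithLp.toLp 2 ![p.1, p.2])‖ ≤
      ∑' m : Fin 2 → ℤ, (if m ≠ 0 ∧ ∀ i, (L : ℤ) ∣ m i then
        ‖mFourierCoeff (Torus.descend (fun y : Momentum => (fun q : Momentum => f (frameLevel μ K q) * V q) ((2 * π) • y))
          (isLatticePeriodic_rescale (Φ := fun q : Momentum => f (frameLevel μ K q) * V q) (levelVertex_periodic_single μ K f hVper))) m‖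
        else 0) := by
  have h := norm_latticeMomentumAvg_sub_zoneIntegral_le (L := L) (contDiff_levelVertex μ K hf hV) (levelVertex_periodic_single μ K f hVper)
  rw [setIntegral_zoneBox_eq_tube μ K hfsupp V] at h
  exact h

end Summit.HubbardSuperconductivity.HubbardSuperconductivity.Theorems.C4a

end
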